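import Summits.ResolutionOfSingularities.ResolutionOfSingularities.Theorems.EquisingularLiftEquisingularLiftNatKeyLetterIncidence
import Summits.ResolutionOfSingularities.ResolutionOfSingularities.Theorems.EquisingularLiftEquisingularLiftNatPreLetterPointStep
import HarnessLib

/-!
# [OURS · L1 W4.5(b) · EL♮(3) · WIDTH TABLE D5 «IMMATURE HOST», supplier row HOPEN, input (IN-2)] G1-P — THE KEY LETTER'S INCIDENCE THROUGH THE OPENING'S POINT STEP
# `TCPlus.keyInc_pointStep : <hG1P of ✓ TCPlus.opening_pointPhase (p671938), verbatim>`

res-L1-w45b-stub-4 g12 (desk R54 / l.83769: «(IN-2) G1-P / (IN-3) G1-CAR instantiations of ✓ p670257 → stub-4»; res-L1-w45b-stub-2 g16 pinned the binder as the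
hypothesis `hG1P` of ✓ `TCPlus.opening_pointPhase`, file l.57–70).  OURS; NOT a statement of any manuscript ([Hironaka2017] is a candidate under adjudication,
nothing of it is asserted); AI-written, weaker than expert review.  No `sorry`; standard axioms; DEF-FREE.  `--supports stmt-ResolutionOfSingularities-20148 --as helper`.

WHAT.  At a regular integral stage `X'` over the DVR `O` with a section `s` (separated structure map), the point step `τ = Bl_{ker s}` with exceptional `𝓢 = (ker s)·𝒪_{X₁}`;
two letters THROUGH the section (`𝓛h, 𝓛j ≤ ker s`) and the immature key letter `𝓜` of EXACT ORDER `a` at the section's closed point `x'` (`𝓜_{x'} = (G)`,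
`G ∈ (ker s)_{x'}^a`, `G ∉ 𝔪_{x'}^{a+1}`) in the (host, face) gauge `𝓜 ≤ 𝓛h^a ⊔ 𝓛h·(ker s)^a ⊔ (ker s)^a·𝓛j`.  CONCLUSION (G1-P):
`St 𝓜 ≤ (St 𝓛h)^a ⊔ St 𝓛h · 𝓢 ⊔ 𝓢 · St 𝓛j`.
PROOF.  (1) FACTORIZATION `𝓜·𝒪_{X₁} = 𝓢^a · St 𝓜` by `comap_eq_pow_mul_strictTransformIdeal_of_packs_of_specializes` — the SPECIALISATION twin of res-L1-w45b-stub-4's ✓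
`comap_eq_pow_mul_strictTransformIdeal_of_packs` (p670257): no quasi-compactness; the cone pack is needed only at `x'` because every point of `X₁` over the section
specialises to a point over `x'` (`s q ⤳ s(closed point)` and the blow-up is a closed map) and stalk identities generise (Literature `stalkIdeal_map_stalkSpecializes`);
the pack at `x'` is K5′'s section frame (✓ `exists_sectionFrame_forall_dim_at`) with the form of `G` (`Ideal.mem_span_pow_iff_exists_isHomogeneous`), non-zero modulo
the frame because `G ∉ 𝔪^{a+1}` (✓ `eval_mem_pow_succ_of_map_mk_eq_zero`).  (2) The G1 calculus (✓ p670257) in three monomials of weights `a`, `a+1`, `a+1`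
(`𝓛h·𝒪 ≤ 𝓢·St 𝓛h`, `𝓛j·𝒪 ≤ 𝓢·St 𝓛j` by ✓ `comap_le_pow_one_mul_strictTransformIdeal`): `𝓢^a·St 𝓜 = 𝓜·𝒪 ≤ 𝓢^a·((St 𝓛h)^a ⊔ St 𝓛h·𝓢 ⊔ 𝓢·St 𝓛j)` and the
effective Cartier factor `𝓢^a` cancels (Literature `IsEffectiveCartier.le_of_mul_le_mul`).  The letters' regularity / principality and `𝓜 ≠ ⊥` in the pinned binder
are not used. [cite: StacksProject, Tag 0804] [cite: Kollar2007, 3.58–3.60] [folklore; pure composition of the cited tree theorems]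
-/

set_option linter.dupNamespace false
set_option linter.overlappingInstances false

noncomputable section

open CategoryTheory CategoryTheory.Limits AlgebraicGeometry TopologicalSpace Topology IsLocalRing
open Literature.AlgebraicGeometry.Resolution
open AlgebraicGeometry.Scheme.IdealSheafData
open Summit.ResolutionOfSingularities.ResolutionOfSingularities.Cruxes.EquisingularLift.StrataSplit

namespace Summit.ResolutionOfSingularities.ResolutionOfSingularities.Cruxes.EquisingularLiftNat.Sections

set_option maxHeartbeats 800000 in -- one instance of res-type-100's chart-algebra stalk theorem (as in ✓ p670257)
/-- **Total transform = exceptional^a · strict transform — SPECIALISATION form** (twin of ✓ `comap_eq_pow_mul_strictTransformIdeal_of_packs`, no quasi-compactness):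
for the blow-up `τ` of `J` and an ideal sheaf `K`, if every point of the blown-up scheme over the centre SPECIALISES to a point over a set `Pk` of PACK POINTS, and at
every pack point the cone pack of order `a` is given (frame `c` of `J_p` quasi-regular with domain quotient, `K_p = (Φ(c))`, `Φ` a form of degree `a`, `Φ ≢ 0 mod (c)`),
then `K·𝒪 = 𝓔^a · St K`.  At a point over a pack point this is res-type-100's stalk theorem; stalk identities generise (Literature `stalkIdeal_map_stalkSpecializes`);
off the exceptional locus both sides are the total transform. [cite: StacksProject, Tag 0804] [cite: Kollar2007, 3.58–3.60] [OURS · L1 W4.5b · D5 G1] -/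
theorem comap_eq_pow_mul_strictTransformIdeal_of_packs_of_specializes {X X₂ : Scheme.{0}} [IsLocallyNoetherian X] [IsLocallyNoetherian X₂]
    (τ : X₂ ⟶ X) (J K : X.IdealSheafData) (hτ : IsBlowup τ J) (a : ℕ) (Pk : Set X)
    (hspec : ∀ x₂ : X₂, τ x₂ ∈ (J.support : Set X) → ∃ x₂' : X₂, x₂ ⤳ x₂' ∧ τ x₂' ∈ Pk)
    (hpack : ∀ p ∈ Pk, p ∈ (J.support : Set X) ∧ ∃ (r : ℕ) (c : Fin r → X.presheaf.stalk p) (Φ : MvPolynomial (Fin r) (X.presheaf.stalk p)),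
      Ideal.span (Set.range c) = stalkIdeal J p ∧ IsQuasiRegular c ∧ IsDomain (X.presheaf.stalk p ⧸ Ideal.span (Set.range c)) ∧
      Φ.IsHomogeneous a ∧ MvPolynomial.map (Ideal.Quotient.mk (Ideal.span (Set.range c))) Φ ≠ 0 ∧ stalkIdeal K p = Ideal.span {MvPolynomial.eval c Φ}) :
    K.comap τ = J.comap τ ^ a * strictTransformIdeal τ J K := by
  classical
  -- adapted from ✓ `comap_eq_pow_mul_strictTransformIdeal_of_packs` (…NatKeyLetterIncidence, res-L1-w45b-stub-4 g11)
  have key : ∀ x' : X₂, τ x' ∈ Pk →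
      stalkIdeal (K.comap τ) x' = stalkIdeal (J.comap τ ^ a * strictTransformIdeal τ J K) x' := by
    intro x' hx'P
    obtain ⟨hx', r, c, Φ, hcJ, hc, hdom, hΦd, hΦ, hK⟩ := hpack (τ x') hx'P
    rw [stalkIdeal_mul, stalkIdeal_pow]
    haveI := hdom
    obtain ⟨j, 𝔔, χ, e, hχ, -, -, hE, hSt, -, -⟩ := exists_stalk_strictTransformIdeal_sup_comap hτ K x' hx' c hcJ hc Φ hΦd hΦ hK
    -- the total transform at `x'`
    have htot : stalkIdeal (K.comap τ) x' = Ideal.span {χ (algebraMap _ _ (MvPolynomial.eval c Φ))} := by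
      rw [stalkIdeal_comap_eq_map_stalkMap, hK, Ideal.map_span, Set.image_singleton, hχ]
    -- homogeneity: `Φ(c) = t^a · Φ(c/t)` in the blow-up algebra
    have hhom : algebraMap _ (blowupAlgebra (Ideal.span (Set.range c)) (c j)) (MvPolynomial.eval c Φ) =
        algebraMap _ (blowupAlgebra (Ideal.span (Set.range c)) (c j)) (c j) ^ a * MvPolynomial.aeval (blowupAlgebra.frac c j) Φ := by
      have h1 : (fun i => algebraMap _ (blowupAlgebra (Ideal.span (Set.range c)) (c j)) (c i)) =
          algebraMap _ (blowupAlgebra (Ideal.span (Set.range c)) (c j)) (c j) • (blowupAlgebra.frac c j) := by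
        funext i
        simp only [Pi.smul_apply, smul_eq_mul]
        exact (blowupAlgebra.algebraMap_mul_gen (Ideal.span (Set.range c)) (c j) (c i) _).symm
      calc algebraMap _ (blowupAlgebra (Ideal.span (Set.range c)) (c j)) (MvPolynomial.eval c Φ)
          = MvPolynomial.eval₂ (algebraMap _ (blowupAlgebra (Ideal.span (Set.range c)) (c j)))
              (fun i => algebraMap _ (blowupAlgebra (Ideal.span (Set.range c)) (c j)) (c i)) Φ := by
            rw [show MvPolynomial.eval c Φ = MvPolynomial.eval₂ (RingHom.id _) c Φ from rfl, MvPolynomial.eval₂_comp_left, RingHom.comp_id]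
            rfl
        _ = MvPolynomial.eval (algebraMap _ (blowupAlgebra (Ideal.span (Set.range c)) (c j)) (c j) • (blowupAlgebra.frac c j))
              (MvPolynomial.map (algebraMap _ (blowupAlgebra (Ideal.span (Set.range c)) (c j))) Φ) := by
            rw [MvPolynomial.eval₂_eq_eval_map, h1]
        _ = algebraMap _ (blowupAlgebra (Ideal.span (Set.range c)) (c j)) (c j) ^ a *
              MvPolynomial.eval (blowupAlgebra.frac c j) (MvPolynomial.map (algebraMap _ (blowupAlgebra (Ideal.span (Set.range c)) (c j))) Φ) :=
            eval_smul_of_isHomogeneous' (hΦd.map _) _ _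
        _ = algebraMap _ (blowupAlgebra (Ideal.span (Set.range c)) (c j)) (c j) ^ a * MvPolynomial.aeval (blowupAlgebra.frac c j) Φ := by
            rw [MvPolynomial.aeval_def, MvPolynomial.eval₂_eq_eval_map]
    rw [htot, hhom, map_mul, map_pow, ← Ideal.span_singleton_mul_span_singleton, ← Ideal.span_singleton_pow, ← hE, ← hSt]
  have off : ∀ x' : X₂, τ x' ∉ (J.support : Set X) →
      stalkIdeal (K.comap τ) x' = stalkIdeal (J.comap τ ^ a * strictTransformIdeal τ J K) x' := by
    intro x' hx'
    have hx'E : x' ∉ (J.comap τ).support := by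
      intro h
      apply hx'
      have h' : x' ∈ ((J.comap τ).support : Set X₂) := h
      rw [Scheme.IdealSheafData.support_comap] at h'
      exact h'
    rw [stalkIdeal_mul, stalkIdeal_pow, stalkIdeal_eq_top_of_not_mem_support hx'E, Ideal.top_pow, Ideal.top_mul,
      stalkIdeal_strictTransformIdeal_of_not_mem τ J K hx'E, stalkIdeal_comap_eq_map_stalkMap]
  refine ext_of_forall_stalkIdeal_eq fun x₂ => ?_
  by_cases hx : τ x₂ ∈ (J.support : Set X)
  · obtain ⟨x₂', hsp, hPk⟩ := hspec x₂ hx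
    rw [← stalkIdeal_map_stalkSpecializes (K.comap τ) hsp, ← stalkIdeal_map_stalkSpecializes (J.comap τ ^ a * strictTransformIdeal τ J K) hsp, key x₂' hPk]
  · exact off x₂ hx

section KeyLetterPointStep

/-- **Over a section, every point of the blow-up specialises to a point over the section's closed point.**  For a section `s` of a separated `r' : X' → Spec O`
(`O` local) and a proper `τ : X₁ → X'` (e.g. a blow-up of a locally Noetherian scheme): if `τ x₁ ∈ range s` then `x₁ ⤳ x₁'` for some `x₁'` with
`τ x₁' = s (closed point)` — `s q ⤳ s (closed point)` and `τ` is a closed map. [folklore] -/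
theorem exists_specializes_over_section_closedPoint (O : Type) [CommRing O] [IsLocalRing O] {X' X₁ : Scheme.{0}}
    (s : Spec (.of O) ⟶ X') (τ : X₁ ⟶ X') [UniversallyClosed τ] (x₁ : X₁) (hx : τ x₁ ∈ Set.range s) :
    ∃ x₁' : X₁, x₁ ⤳ x₁' ∧ τ x₁' = s (closedPoint O) := by
  obtain ⟨q, hq⟩ := hx
  have h1 : τ x₁ ⤳ s (closedPoint O) := by
    rw [← hq]; exact (IsLocalRing.specializes_closedPoint q).map s.continuous
  have hcl : IsClosed (τ '' closure {x₁}) := τ.isClosedMap _ isClosed_closure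
  have hsub : closure {τ x₁} ⊆ τ '' closure {x₁} :=
    closure_minimal (Set.singleton_subset_iff.mpr ⟨x₁, subset_closure rfl, rfl⟩) hcl
  obtain ⟨x₁', hx₁', hτ⟩ := hsub h1.mem_closure
  exact ⟨x₁', specializes_iff_mem_closure.mpr hx₁', hτ⟩

variable (O : Type) [CommRing O] [IsDomain O] [IsDiscreteValuationRing O]

/-- **FACTORIZATION THROUGH A POINT STEP from the order datum at the section's closed point**: `X'` regular with a section `s` of the separated `r'`, `τ = Bl_{ker s}`,
an ideal sheaf `𝓜` whose stalk at `x' = s (closed point)` is generated by `G ∈ (ker s)_{x'}^a ∖ 𝔪_{x'}^{a+1}` (exact order `a`): `𝓜·𝒪_{X₁} = ((ker s)·𝒪_{X₁})^a · St 𝓜`.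
(K5′'s section frame ✓ `exists_sectionFrame_forall_dim_at` gives the pack at `x'`; `comap_eq_pow_mul_strictTransformIdeal_of_packs_of_specializes`.)
[cite: StacksProject, Tag 0804] [OURS · L1 W4.5b · D5 G1, (IN-2) factorization] -/
theorem comap_eq_pow_mul_strictTransformIdeal_of_section_of_order {X' X₁ : Scheme.{0}} [IsLocallyNoetherian X'] [IsLocallyNoetherian X₁]
    (hX : Scheme.IsRegular X') (r' : X' ⟶ Spec (.of O)) [IsSeparated r'] (s : Spec (.of O) ⟶ X') (hs : s ≫ r' = 𝟙 _)
    (τ : X₁ ⟶ X') (hτ : IsBlowup τ s.ker) (𝓜 : X'.IdealSheafData) (a : ℕ) (x' : X') (hx' : s (closedPoint O) = x')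
    (hG : ∃ Gst : X'.presheaf.stalk x', stalkIdeal 𝓜 x' = Ideal.span {Gst} ∧ Gst ∈ stalkIdeal s.ker x' ^ a ∧ Gst ∉ maximalIdeal (X'.presheaf.stalk x') ^ (a + 1)) :
    𝓜.comap τ = s.ker.comap τ ^ a * strictTransformIdeal τ s.ker 𝓜 := by
  classical
  haveI : IsProper τ := hτ.isProper
  have hsupp : (s.ker.support : Set X') = Set.range s := (section_isClosedImmersion_and_isRegular_ker O X' r' s hs).2.2.2
  haveI hreg : IsRegularLocalRing (X'.presheaf.stalk x') := hX x'
  obtain ⟨ϖ, hϖ⟩ := IsDiscreteValuationRing.exists_irreducible O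
  -- the pack at `x'`: section frame, form of `G`, non-vanishing modulo the frame
  obtain ⟨n, c, θR, hcI, hc, hdom, -, h𝔪, -, -⟩ := exists_sectionFrame_forall_dim_at O r' s hs x' hx' hreg ϖ hϖ
  obtain ⟨Gst, h𝓜G, hGa, hGm⟩ := hG
  have hGa' : Gst ∈ Ideal.span (Set.range c) ^ a := by rw [hcI]; exact hGa
  obtain ⟨Φ, hΦd, hΦev⟩ := (Ideal.mem_span_pow_iff_exists_isHomogeneous c Gst).mp hGa'
  have hK : stalkIdeal 𝓜 x' = Ideal.span {MvPolynomial.eval c Φ} := by rw [hΦev]; exact h𝓜G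
  have hcm : Ideal.span (Set.range c) ≤ maximalIdeal (X'.presheaf.stalk x') := le_sup_left.trans h𝔪.le
  have hΦ : MvPolynomial.map (Ideal.Quotient.mk (Ideal.span (Set.range c))) Φ ≠ 0 := by
    intro h0
    apply hGm
    have h1 : Gst ∈ Ideal.span (Set.range c) ^ (a + 1) := hΦev ▸ eval_mem_pow_succ_of_map_mk_eq_zero c hΦd h0
    exact pow_le_pow_left' hcm (a + 1) h1
  have hx'supp : x' ∈ (s.ker.support : Set X') := by rw [hsupp, ← hx']; exact ⟨_, rfl⟩
  refine comap_eq_pow_mul_strictTransformIdeal_of_packs_of_specializes τ s.ker 𝓜 hτ a {x'} ?_ ?_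
  · intro x₂ hx₂
    rw [hsupp] at hx₂
    obtain ⟨x₂', hsp, hτx⟩ := exists_specializes_over_section_closedPoint O s τ x₂ hx₂
    exact ⟨x₂', hsp, by rw [hτx, hx']; exact Set.mem_singleton x'⟩
  · intro p hp
    rw [Set.mem_singleton_iff] at hp
    subst hp
    exact ⟨hx'supp, n, c, Φ, hcI, hc, hdom, hΦd, hΦ, hK⟩

/-- **(IN-2) G1-P — THE KEY LETTER'S INCIDENCE THROUGH THE OPENING'S POINT STEP**, the `hG1P` hypothesis of ✓ `TCPlus.opening_pointPhase` (p671938) VERBATIM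
(see the module docstring). [cite: StacksProject, Tag 0804] [cite: Kollar2007, 3.58–3.60] [OURS · L1 W4.5b · WIDTH TABLE D5, HOPEN (IN-2)] -/
theorem TCPlus.keyInc_pointStep :
    ∀ (O : Type) [CommRing O] [IsDomain O] [IsDiscreteValuationRing O] {X' X₁ : Scheme.{0}} [IsIntegral X'] [IsLocallyNoetherian X'] [IsLocallyNoetherian X₁],
        Scheme.IsRegular X' → ∀ (r' : X' ⟶ Spec (.of O)) [IsSeparated r'] (s : Spec (.of O) ⟶ X'), s ≫ r' = 𝟙 _ →
        ∀ (τ : X₁ ⟶ X'), IsBlowup τ s.ker →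
        -- two letters through the section (regular principal models containing it) and the immature key letter of exact order `a` at the section's closed point
        ∀ (𝓛h 𝓛j 𝓜 : X'.IdealSheafData) (a : ℕ) (x' : X'), s (IsLocalRing.closedPoint O) = x' → 𝓛h ≤ s.ker → 𝓛j ≤ s.ker →
          Scheme.IsRegular 𝓛h.subscheme → (∀ z : X', (stalkIdeal 𝓛h z).IsPrincipal) → Scheme.IsRegular 𝓛j.subscheme → (∀ z : X', (stalkIdeal 𝓛j z).IsPrincipal) →
          (∀ z : X', (stalkIdeal 𝓜 z).IsPrincipal) → 𝓜 ≠ ⊥ →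
          (∃ Gst : X'.presheaf.stalk x', stalkIdeal 𝓜 x' = Ideal.span {Gst} ∧ Gst ∈ stalkIdeal s.ker x' ^ a ∧ Gst ∉ IsLocalRing.maximalIdeal (X'.presheaf.stalk x') ^ (a + 1)) →
          𝓜 ≤ 𝓛h ^ a ⊔ 𝓛h * s.ker ^ a ⊔ s.ker ^ a * 𝓛j →
          strictTransformIdeal τ s.ker 𝓜 ≤ strictTransformIdeal τ s.ker 𝓛h ^ a ⊔ strictTransformIdeal τ s.ker 𝓛h * s.ker.comap τ ⊔ s.ker.comap τ * strictTransformIdeal τ s.ker 𝓛j := by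
  intro O _ _ _ X' X₁ _ _ _ hX r' _ s hs τ hτ 𝓛h 𝓛j 𝓜 a x' hx' hLh hLj _ _ _ _ _ _ hG hInc
  have hfac : 𝓜.comap τ = s.ker.comap τ ^ a * strictTransformIdeal τ s.ker 𝓜 :=
    comap_eq_pow_mul_strictTransformIdeal_of_section_of_order O hX r' s hs τ hτ 𝓜 a x' hx' hG
  -- the per-letter bounds (weight one: the letters contain the centre)
  have hh : 𝓛h.comap τ ≤ s.ker.comap τ * strictTransformIdeal τ s.ker 𝓛h := by
    have h := comap_le_pow_one_mul_strictTransformIdeal τ hτ hLh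
    rwa [pow_one] at h
  have hj : 𝓛j.comap τ ≤ s.ker.comap τ * strictTransformIdeal τ s.ker 𝓛j := by
    have h := comap_le_pow_one_mul_strictTransformIdeal τ hτ hLj
    rwa [pow_one] at h
  -- the three monomials, then cancel `𝓢^a`
  set 𝓢 := s.ker.comap τ with h𝓢
  set Ph := strictTransformIdeal τ s.ker 𝓛h with hPh
  set Qj := strictTransformIdeal τ s.ker 𝓛j with hQj
  apply (hτ.isEffectiveCartier.pow a).le_of_mul_le_mul
  calc 𝓢 ^ a * strictTransformIdeal τ s.ker 𝓜 = 𝓜.comap τ := hfac.symm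
    _ ≤ (𝓛h ^ a ⊔ 𝓛h * s.ker ^ a ⊔ s.ker ^ a * 𝓛j).comap τ := Scheme.IdealSheafData.comap_mono τ hInc
    _ = 𝓛h.comap τ ^ a ⊔ 𝓛h.comap τ * 𝓢 ^ a ⊔ 𝓢 ^ a * 𝓛j.comap τ := by
        rw [Scheme.IdealSheafData.comap_sup, Scheme.IdealSheafData.comap_sup, comap_mul, comap_mul, comap_pow, comap_pow]
    _ ≤ (𝓢 * Ph) ^ a ⊔ (𝓢 * Ph) * 𝓢 ^ a ⊔ 𝓢 ^ a * (𝓢 * Qj) :=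
        sup_le_sup (sup_le_sup (pow_le_pow_left' hh a) (mul_le_mul' hh le_rfl)) (mul_le_mul' le_rfl hj)
    _ ≤ 𝓢 ^ a * (Ph ^ a ⊔ Ph * 𝓢 ⊔ 𝓢 * Qj) := by
        refine sup_le (sup_le ?_ ?_) ?_
        · rw [mul_pow]; exact mul_le_mul' le_rfl (le_sup_left.trans le_sup_left)
        · rw [show 𝓢 * Ph * 𝓢 ^ a = 𝓢 ^ a * (Ph * 𝓢) by ring]; exact mul_le_mul' le_rfl (le_sup_right.trans le_sup_left)
        · exact mul_le_mul' le_rfl le_sup_right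

end KeyLetterPointStep

end Summit.ResolutionOfSingularities.ResolutionOfSingularities.Cruxes.EquisingularLiftNat.Sections

end
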